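import Summits.AtomisticToContinuum.Crystallization.Theorems.ExcessDecayLiouvilleRelaxationContraction

/-!
# Route `ExcessDecayLiouville`: relaxed affine two-lattices have no self-force (relaxation, IV)

Harmonic-replacement architecture for item `ExcessDecay` (stmt-AtomisticToContinuum-9334), nonlinear half.
For an affine-plus-shift background `aff` (`aff(t m + Az) = a m + B(t m + Az − x₀)`) the displaced
self-force `G(p) = Σ'_{q ≠ p} F((p − q) + (aff p − aff q))` of `ExcessDecayLiouvilleSelfForce` is
sublattice-constant; here:

* `exists_sitesReflect` : the point reflection `q ↦ t 0 + t 1 − q` is a self-equivalence of the site set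
  exchanging the two sublattices;
* `dispForce_one_eq_neg` : Newton's third law `G(t 1) = −G(t 0)` (reflect the lattice sum; `F` is odd);
* `dispForce_zero_eq_natForce` : `G(t 0) = Ψ_B(a 0 − a 1)`, the natural force of
  `ExcessDecayLiouvilleRelaxationContraction` at the jump `a 0 − a 1`;
* `dispForce_eq_zero_of_natForce` : hence `Ψ_B(a 0 − a 1) = 0` implies `G ≡ 0` on all sites;
* `exists_relaxed_field` : under harmonic stability, shifting sublattice `0` of a nearly relaxed `aff` by
  the relaxed jump correction `ξ` (`‖ξ‖ ≤ (4/κ)‖G(t 0)‖`) gives a field with `G ≡ 0`.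

All `[folklore]`; helper lemmas, nothing here closes an item.
-/

noncomputable section

namespace Summit.AtomisticToContinuum.Crystallization.Theorems.ExcessDecayLiouville

open scoped BigOperators Topology InnerProductSpace RealInnerProductSpace Classical
open Literature.MathematicalPhysics.StatisticalMechanics
open Summit.AtomisticToContinuum.Crystallization.Theorems.PhononStabilityNegative

local notation "E3" => EuclideanSpace ℝ (Fin 3)

-- Local notation: the force-constant map `K(e)w = h(|e|²)w + 2⟪e,w⟫h′(|e|²)e` (`= forceConst e w`).
local notation3 "𝕂[" e "] " w:max =>
  (-((‖e‖ ^ 2)⁻¹) ^ 7 + ((‖e‖ ^ 2)⁻¹) ^ 4) • w + (2 * ⟪e, w⟫ * (7 * ((‖e‖ ^ 2)⁻¹) ^ 8 - 4 * ((‖e‖ ^ 2)⁻¹) ^ 5)) • e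
-- Local notation: the pair force `F(x) = h(|x|²) x`.
local notation3 "𝐅[" x "]" => ((-((‖x‖ ^ 2)⁻¹) ^ 7 + ((‖x‖ ^ 2)⁻¹) ^ 4) • x)

section

variable {t : Fin 2 → E3} {A : E3 →L[ℝ] E3} {κ : ℝ} {B : E3 →L[ℝ] E3}
  {aff : E3 → E3} {a : Fin 2 → E3} {x₀ : E3}

set_option quotPrecheck false in
-- Local notation: the operator row `(L v)(p)`.
local notation "𝕃" v:max " @ " p:max =>
  tsum (fun q : Sites₀ t A => (if ((p : Sites₀ t A) : E3) ≠ q then 𝕂[((p : Sites₀ t A) : E3) - q] (v ((p : Sites₀ t A) : E3) - v q) else 0))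

set_option quotPrecheck false in
-- Local notation: the natural force `Ψ_B(s)` at `t 0` of the two-lattice displaced by slope `B` and jump `s`.
local notation "𝚿[" B ", " s "]" =>
  tsum (fun q : Sites₀ t A => (if (t 0 : E3) ≠ q then
    𝐅[((t 0 : E3) - q) + (B ((t 0 : E3) - q) + (if (∃ z ∈ Λ₀, (q : E3) = t 1 + A z) then s else 0))] else 0))

set_option quotPrecheck false in
-- Local notation: the displaced self-force `G(p)` of the background `aff`.
local notation "𝐆[" aff "] " p:max =>
  tsum (fun q : Sites₀ t A => (if (p : E3) ≠ q then 𝐅[((p : E3) - q) + (aff (p : E3) - aff q)] else 0))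

/-! ## The point reflection of the site set -/

/-- The reflected point `t 0 + t 1 − (t m + A z)` is the site `t (1 − m) + A(−z)`. [folklore] -/
theorem reflect_mem {q : E3} (hq : q ∈ Sites₀ t A) : t 0 + t 1 - q ∈ Sites₀ t A := by
  obtain ⟨m, z, hz, rfl⟩ := hq
  fin_cases m
  · exact ⟨1, -z, neg_mem_Λ₀ hz, by simp only [Fin.zero_eta, Fin.isValue, map_neg]; abel⟩
  · exact ⟨0, -z, neg_mem_Λ₀ hz, by simp only [Fin.mk_one, Fin.isValue, map_neg]; abel⟩

/-- **The point reflection `q ↦ t 0 + t 1 − q`** as a self-equivalence of the site type. [folklore] -/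
theorem exists_sitesReflect :
    ∃ e : Sites₀ t A ≃ Sites₀ t A, ∀ q : Sites₀ t A, ((e q : Sites₀ t A) : E3) = t 0 + t 1 - q :=
  ⟨{ toFun := fun q => ⟨t 0 + t 1 - q, reflect_mem q.2⟩
     invFun := fun q => ⟨t 0 + t 1 - q, reflect_mem q.2⟩
     left_inv := fun q => by ext; simp
     right_inv := fun q => by ext; simp }, fun _ => rfl⟩

/-! ## Newton's third law for the displaced self-force -/

/-- The reflected displaced bond is the negative of the original one:
`(t 1 − ι q) + (aff(t 1) − aff(ι q)) = −((t 0 − q) + (aff(t 0) − aff q))`. [folklore] -/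
theorem reflect_bond (haff : ∀ (m : Fin 2) (z : E3), z ∈ Λ₀ → aff (t m + A z) = a m + B (t m + A z - x₀))
    (q : Sites₀ t A) :
    ((t 1 : E3) - (t 0 + t 1 - q)) + (aff (t 1) - aff (t 0 + t 1 - q)) =
      -(((t 0 : E3) - q) + (aff (t 0) - aff q)) := by
  obtain ⟨m, z, hz, hq⟩ := q.2
  have h0 : aff (t 0) = a 0 + B (t 0 - x₀) := by simpa using haff 0 0 zero_mem_Λ₀
  have h1 : aff (t 1) = a 1 + B (t 1 - x₀) := by simpa using haff 1 0 zero_mem_Λ₀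
  have hq' : aff q = a m + B (q - x₀) := by rw [hq]; exact haff m z hz
  fin_cases m <;> simp only [Fin.zero_eta, Fin.isValue, Fin.mk_one] at hq hq'
  · have hr : t 0 + t 1 - (q : E3) = t 1 + A (-z) := by rw [hq, map_neg]; abel
    have hr' : aff (t 0 + t 1 - q) = a 1 + B (t 0 + t 1 - q - x₀) := by rw [hr]; exact haff 1 (-z) (neg_mem_Λ₀ hz)
    rw [hr', h1, h0, hq']
    simp only [map_sub, map_add]
    abel
  · have hr : t 0 + t 1 - (q : E3) = t 0 + A (-z) := by rw [hq, map_neg]; abel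
    have hr' : aff (t 0 + t 1 - q) = a 0 + B (t 0 + t 1 - q - x₀) := by rw [hr]; exact haff 0 (-z) (neg_mem_Λ₀ hz)
    rw [hr', h1, h0, hq']
    simp only [map_sub, map_add]
    abel

/-- **Newton's third law**: the displaced self-forces on the two sublattices are opposite,
`G(t 1) = −G(t 0)`. [folklore] -/
theorem dispForce_one_eq_neg (haff : ∀ (m : Fin 2) (z : E3), z ∈ Λ₀ → aff (t m + A z) = a m + B (t m + A z - x₀)) :
    𝐆[aff] (⟨t 1, 1, 0, zero_mem_Λ₀, by simp⟩ : Sites₀ t A) = -𝐆[aff] (⟨t 0, t0_mem_sites⟩ : Sites₀ t A) := by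
  obtain ⟨e, he⟩ := exists_sitesReflect (t := t) (A := A)
  rw [← e.tsum_eq, ← tsum_neg]
  refine tsum_congr fun q => ?_
  rw [he q]
  have hb := reflect_bond haff q
  have hiff : ((t 1 : E3) ≠ t 0 + t 1 - q) ↔ ((t 0 : E3) ≠ q) := by
    constructor
    · intro h h'; exact h (by rw [← h']; abel)
    · intro h h'
      rw [eq_sub_iff_add_eq, add_comm (t 1)] at h'
      exact h (add_right_cancel h').symm
  by_cases h : (t 0 : E3) ≠ q
  · rw [if_pos (hiff.2 h), if_pos h, hb, pairForce_neg]
  · rw [if_neg (fun h' => h (hiff.1 h')), if_neg h, neg_zero]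

/-! ## The self-force in jump form; relaxed fields -/

/-- **The self-force at the base site is the natural force at the jump `a 0 − a 1`.** [folklore] -/
theorem dispForce_zero_eq_natForce (hA : Adm₀ A) (hI : Inner₀ t A)
    (haff : ∀ (m : Fin 2) (z : E3), z ∈ Λ₀ → aff (t m + A z) = a m + B (t m + A z - x₀)) :
    𝐆[aff] (⟨t 0, t0_mem_sites⟩ : Sites₀ t A) = 𝚿[B, a 0 - a 1] := by
  refine tsum_congr fun q => ?_
  have h0 : aff (t 0) = a 0 + B (t 0 - x₀) := by simpa using haff 0 0 zero_mem_Λ₀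
  obtain ⟨m, z, hz, hq⟩ := q.2
  have hq' : aff q = a m + B (q - x₀) := by rw [hq]; exact haff m z hz
  have hdiff : aff (t 0) - aff q = B (t 0 - q) + (if (∃ z ∈ Λ₀, (q : E3) = t 1 + A z) then a 0 - a 1 else 0) := by
    rw [h0, hq']
    fin_cases m <;> simp only [Fin.zero_eta, Fin.isValue, Fin.mk_one] at hq ⊢
    · have hq0 : ¬ ∃ z' ∈ Λ₀, (q : E3) = t 1 + A z' := by
        rintro ⟨z', hz', h⟩; exact sublattice_ne hA hI hz hz' (hq.symm.trans h)
      rw [if_neg hq0]; simp only [map_sub]; abel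
    · rw [if_pos ⟨z, hz, hq⟩]; simp only [map_sub]; abel
  show (if (t 0 : E3) ≠ q then 𝐅[((t 0 : E3) - q) + (aff (t 0) - aff q)] else 0) = _
  rw [hdiff]

/-- **A field with vanishing natural force has no self-force anywhere** (sublattice constancy on `S₀`,
Newton's third law for `S₁`). [folklore] -/
theorem dispForce_eq_zero_of_natForce (hA : Adm₀ A) (hI : Inner₀ t A)
    (haff : ∀ (m : Fin 2) (z : E3), z ∈ Λ₀ → aff (t m + A z) = a m + B (t m + A z - x₀))
    (h0 : 𝚿[B, a 0 - a 1] = 0) (p : Sites₀ t A) : 𝐆[aff] p = 0 := by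
  have hbase : 𝐆[aff] (⟨t 0, t0_mem_sites⟩ : Sites₀ t A) = 0 := by rw [dispForce_zero_eq_natForce hA hI haff, h0]
  obtain ⟨m, z, hz, hp⟩ := p.2
  have hconst := dispForce_sublattice_const (t := t) (A := A) haff m zero_mem_Λ₀ hz
  rw [map_zero, add_zero] at hconst
  show (∑' q : Sites₀ t A, (if (p : E3) ≠ q then 𝐅[((p : E3) - q) + (aff (p : E3) - aff q)] else 0)) = 0
  rw [hp, hconst]
  fin_cases m
  · exact hbase
  · have h1 := dispForce_one_eq_neg (t := t) (A := A) haff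
    rw [hbase, neg_zero] at h1
    exact h1

/-- **Relaxing a nearly relaxed affine two-lattice.**  Under harmonic stability (`0 < κ ≤ 1`), if
`‖B‖, ‖a 0 − a 1‖ ≤ 10⁻¹⁰κ` and the self-force at `t 0` is `≤ 10⁻¹¹κ²`, then shifting sublattice `0` by some
`ξ` with `‖ξ‖ ≤ (4/κ)‖G(t 0)‖` kills the self-force at every site. [folklore] -/
theorem exists_relaxed_field (hA : Adm₀ A) (hI : Inner₀ t A) (hκ0 : 0 < κ) (hκ1 : κ ≤ 1)
    (hκ : ∀ v : E3 → E3, (Function.support v).Finite → Function.support v ⊆ Sites₀ t A →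
      κ * nnForm t A v ≤ ∑' p : Sites₀ t A, ⟪𝕃 v @ p, v p⟫)
    (haff : ∀ (m : Fin 2) (z : E3), z ∈ Λ₀ → aff (t m + A z) = a m + B (t m + A z - x₀))
    (hB : ‖B‖ ≤ κ / 10 ^ 10) (ha : ‖a 0 - a 1‖ ≤ κ / 10 ^ 10)
    (hG : ‖𝐆[aff] (⟨t 0, t0_mem_sites⟩ : Sites₀ t A)‖ ≤ κ ^ 2 / 10 ^ 11) :
    ∃ ξ : E3, ‖ξ‖ ≤ 4 / κ * ‖𝐆[aff] (⟨t 0, t0_mem_sites⟩ : Sites₀ t A)‖ ∧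
      (∀ (m : Fin 2) (z : E3), z ∈ Λ₀ →
        (fun x : E3 => aff x + (if (∃ z ∈ Λ₀, x = t 0 + A z) then ξ else 0)) (t m + A z) =
          (![a 0 + ξ, a 1] : Fin 2 → E3) m + B (t m + A z - x₀)) ∧
      ∀ p : Sites₀ t A, 𝐆[fun x : E3 => aff x + (if (∃ z ∈ Λ₀, x = t 0 + A z) then ξ else 0)] p = 0 := by
  have hΨ := dispForce_zero_eq_natForce hA hI haff
  rw [hΨ] at hG ⊢
  obtain ⟨s, hs, hs0⟩ := exists_natForce_zero hA hI hκ0 hκ1 hκ hB ha hG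
  refine ⟨s - (a 0 - a 1), hs, ?_, ?_⟩
  · intro m z hz
    fin_cases m
    · simp only [Fin.zero_eta, Fin.isValue, Matrix.cons_val_zero]
      rw [if_pos ⟨z, hz, rfl⟩, haff 0 z hz]; abel
    · have h1 : ¬ ∃ z' ∈ Λ₀, t 1 + A z = t 0 + A z' := fun ⟨z', hz', h⟩ => sublattice_ne hA hI hz' hz h.symm
      simp only [Fin.mk_one, Fin.isValue, Matrix.cons_val_one, Matrix.cons_val_zero]
      rw [if_neg h1, haff 1 z hz, add_zero]
  · have haff' : ∀ (m : Fin 2) (z : E3), z ∈ Λ₀ →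
        (fun x : E3 => aff x + (if (∃ z ∈ Λ₀, x = t 0 + A z) then s - (a 0 - a 1) else 0)) (t m + A z) =
          (![a 0 + (s - (a 0 - a 1)), a 1] : Fin 2 → E3) m + B (t m + A z - x₀) := by
      intro m z hz
      fin_cases m
      · simp only [Fin.zero_eta, Fin.isValue, Matrix.cons_val_zero]
        rw [if_pos ⟨z, hz, rfl⟩, haff 0 z hz]; abel
      · have h1 : ¬ ∃ z' ∈ Λ₀, t 1 + A z = t 0 + A z' := fun ⟨z', hz', h⟩ => sublattice_ne hA hI hz' hz h.symm
        simp only [Fin.mk_one, Fin.isValue, Matrix.cons_val_one, Matrix.cons_val_zero]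
        rw [if_neg h1, haff 1 z hz, add_zero]
    have e : (![a 0 + (s - (a 0 - a 1)), a 1] : Fin 2 → E3) 0 - (![a 0 + (s - (a 0 - a 1)), a 1] : Fin 2 → E3) 1 = s := by
      simp only [Fin.isValue, Matrix.cons_val_zero, Matrix.cons_val_one]; abel
    have h0' : 𝚿[B, (![a 0 + (s - (a 0 - a 1)), a 1] : Fin 2 → E3) 0 - (![a 0 + (s - (a 0 - a 1)), a 1] : Fin 2 → E3) 1] = 0 := by
      rw [e]; exact hs0
    intro p
    exact dispForce_eq_zero_of_natForce (B := B) (x₀ := x₀)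
      (aff := fun x : E3 => aff x + (if (∃ z ∈ Λ₀, x = t 0 + A z) then s - (a 0 - a 1) else 0))
      (a := (![a 0 + (s - (a 0 - a 1)), a 1] : Fin 2 → E3)) hA hI haff' h0' p

end

end Summit.AtomisticToContinuum.Crystallization.Theorems.ExcessDecayLiouville

end
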